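import Summits.CriticalPhenomena.PercolationContinuityZ3.Theorems.PercNearOneGluingNoHeavyQuantFarSunCertLayer
import HarnessLib

/-!
# FAR beyond trees: configuration-level two-copy expectations and the law-level symmetrisation for a CONFIGURATION-LEVEL pair weight
# (part 1 of 2 of `TK.sunFAR_of_cfgCert`)

builds on p205010 (kernel theorem, internal audit signed; external expert review pending)

Support file (`--supports stmt-CriticalPhenomena-4575`), seat `prim-cert-1` (gen 26); memo `prim-cert-1/FROM-prim-cert-1-g26-*.md`.
`…QuantFarSunCertLayer` (`TK.sunFAR_of_layerCert`, gen 25) reduces `SunFAR K j` to a certificate `a_k(R'), b(R')` indexed by the ghost copy's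
REACHED SET `R'`.  For layers `j ≥ 2` no `K`-uniform certificate of that kind with a finite type system exists (the entries must decay like
`d²/K` near the ends, gen 26 memo §1); the natural larger class lets the certificate depend on the ghost copy's whole CONFIGURATION
`(Q', m, m')` — its open-hair set `Q' ⊆ range K` (also at uncovered positions) and its two arc extents — i.e. on its coverage `cov K m m'`
and its reached set `Q' ∩ cov K m m'` separately.  This file and `…QuantFarSunCfgCert` record the corresponding generic final step, verbatim parallel to `TK.sunFAR_of_layerCert`; here:
* `TK.tcEc`, `TK.tcE2c` — one- and two-copy expectations of functions of the configuration(s) in the independent two-chain representation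
  (`TK.tcE f = TK.tcEc (f ∘ reached)`), with their linearity / product / exchange / monotonicity lemmas;
* `TK.corePSc`, `TK.OmegaGc`, `TK.revealc_step`, `TK.revealc_nonneg`, `TK.HHc_nonneg`, **`TK.tcE2c_nonneg_of_core`** — the law-level
  symmetrisation for an arbitrary symmetric configuration-level pair weight `Wc` under the configuration-level CORE INEQUALITY
  (nested pair of arc extents + its suffix swap, sure hairs `Z`, split hairs `T` — the split hairs are now recorded in the configurations:
  for `m ≤ l ≤ K+1`, `a ≤ b ≤ K`, disjoint `Z, T ⊆ range K`: `0 ≤ Σ_{J⊆T} Wc (Z∪J) l a (Z∪T∖J) m b + Σ_{J⊆T} Wc (Z∪J) l b (Z∪T∖J) m a`);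
The certificate and the final theorem `TK.sunFAR_of_cfgCert` are in `…QuantFarSunCfgCert`.
No sorries; standard axioms.  Elementary [this work].
-/

noncomputable section

namespace Summit.CriticalPhenomena.PercolationContinuityZ3.Theorems.HairyCycle

namespace TK

open Finset

variable {K : ℕ}

/-! ## Configuration-level expectations -/

/-- ONE-COPY two-chain expectation of a function of the configuration `(Q, l, l')` (open hairs, prefix extent, suffix extent). [this work] -/
def tcEc (K : ℕ) (g h : ℕ → ℝ) (f : Finset ℕ → ℕ → ℕ → ℝ) : ℝ :=
  ∑ Q ∈ (range K).powerset, ∑ l ∈ range (K + 2), ∑ l' ∈ range (K + 1), hairW K h Q * aL K g l * bM K g l' * f Q l l'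

/-- TWO-COPY (independent copies) two-chain expectation of a function of the two configurations. [this work] -/
def tcE2c (K : ℕ) (g h : ℕ → ℝ) (F : Finset ℕ → ℕ → ℕ → Finset ℕ → ℕ → ℕ → ℝ) : ℝ :=
  ∑ Q ∈ (range K).powerset, ∑ Q' ∈ (range K).powerset,
    ∑ l ∈ range (K + 2), ∑ l' ∈ range (K + 1), ∑ m ∈ range (K + 2), ∑ m' ∈ range (K + 1),
      hairW K h Q * hairW K h Q' * (aL K g l * bM K g l' * (aL K g m * bM K g m')) * F Q l l' Q' m m'

/-- `tcE` is `tcEc` of the function read through the reached set. [this work] -/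
theorem tcE_eq_tcEc (g h : ℕ → ℝ) (f : Finset ℕ → ℝ) : tcE K g h f = tcEc K g h (fun Q l l' => f (Q ∩ cov K l l')) := rfl

/-- Linearity of `tcEc`. [this work] -/
theorem tcEc_lin (g h : ℕ → ℝ) (a b : ℝ) (f f' : Finset ℕ → ℕ → ℕ → ℝ) :
    tcEc K g h (fun Q l l' => a * f Q l l' + b * f' Q l l') = a * tcEc K g h f + b * tcEc K g h f' := by
  unfold tcEc
  simp only [Finset.mul_sum, ← Finset.sum_add_distrib]
  refine Finset.sum_congr rfl fun Q _ => Finset.sum_congr rfl fun l _ => Finset.sum_congr rfl fun l' _ => by ring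

/-- `tcEc` of a finite sum of functions. [this work] -/
theorem tcEc_sum (g h : ℕ → ℝ) (s : Finset ℕ) (f : ℕ → Finset ℕ → ℕ → ℕ → ℝ) :
    tcEc K g h (fun Q l l' => ∑ k ∈ s, f k Q l l') = ∑ k ∈ s, tcEc K g h (f k) := by
  induction s using Finset.induction_on with
  | empty =>
    simp only [Finset.sum_empty]
    have := tcEc_lin (K := K) g h 0 0 (fun _ _ _ => 0) (fun _ _ _ => 0)
    simp only [zero_mul, add_zero] at this
    exact this
  | insert k s hk ih =>
    rw [Finset.sum_insert hk, ← ih]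
    have := tcEc_lin (K := K) g h 1 1 (f k) (fun Q l l' => ∑ k ∈ s, f k Q l l')
    simp only [one_mul] at this
    rw [← this]
    exact congrArg _ (funext fun Q => funext fun l => funext fun l' => Finset.sum_insert hk)

/-- Monotonicity of `tcEc` for `g, h ∈ [0,1]` (on configurations with `Q ⊆ range K`, `l ≤ K+1`, `l' ≤ K`). [this work] -/
theorem tcEc_mono {g h : ℕ → ℝ} (hg : ∀ m, m ≤ K → 0 ≤ g m ∧ g m ≤ 1) (hh : ∀ k, k < K → 0 ≤ h k ∧ h k ≤ 1)
    {f f' : Finset ℕ → ℕ → ℕ → ℝ} (hf : ∀ Q, Q ⊆ range K → ∀ l, l ≤ K + 1 → ∀ l', l' ≤ K → f Q l l' ≤ f' Q l l') :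
    tcEc K g h f ≤ tcEc K g h f' := by
  unfold tcEc
  refine Finset.sum_le_sum fun Q hQ => Finset.sum_le_sum fun l hl => Finset.sum_le_sum fun l' hl' => ?_
  rw [Finset.mem_powerset] at hQ
  rw [Finset.mem_range] at hl hl'
  exact mul_le_mul_of_nonneg_left (hf Q hQ l (by omega) l' (by omega))
    (mul_nonneg (mul_nonneg (hairW_nonneg hh Q) (aL_nonneg hg l)) (bM_nonneg hg (by omega)))

/-- `tcEc` of a constant. [this work] -/
theorem tcEc_const (g h : ℕ → ℝ) (c : ℝ) : tcEc K g h (fun _ _ _ => c) = c := by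
  rw [show tcEc K g h (fun _ _ _ => c) = tcE K g h (fun _ => c) from rfl, tcE_const]

/-- `tcEc f ≥ 0` for `f ≥ 0` (`g, h ∈ [0,1]`). [this work] -/
theorem tcEc_nonneg {g h : ℕ → ℝ} (hg : ∀ m, m ≤ K → 0 ≤ g m ∧ g m ≤ 1) (hh : ∀ k, k < K → 0 ≤ h k ∧ h k ≤ 1)
    {f : Finset ℕ → ℕ → ℕ → ℝ} (hf : ∀ Q, Q ⊆ range K → ∀ l, l ≤ K + 1 → ∀ l', l' ≤ K → 0 ≤ f Q l l') : 0 ≤ tcEc K g h f := by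
  have := tcEc_mono hg hh (f := fun _ _ _ => (0 : ℝ)) (f' := f) hf
  rwa [tcEc_const] at this

/-- Mixed product: a function of copy 1's reached set times a function of copy 2's configuration. [this work] -/
theorem tcE2c_prod (g h : ℕ → ℝ) (f : Finset ℕ → ℝ) (f' : Finset ℕ → ℕ → ℕ → ℝ) :
    tcE2c K g h (fun Q l l' Q' m m' => f (Q ∩ cov K l l') * f' Q' m m') = tcE K g h f * tcEc K g h f' := by
  unfold tcE2c tcE tcEc
  rw [Finset.sum_mul_sum]
  refine Finset.sum_congr rfl fun Q _ => Finset.sum_congr rfl fun Q' _ => ?_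
  rw [Finset.sum_mul]
  refine Finset.sum_congr rfl fun l _ => ?_
  rw [Finset.sum_mul]
  refine Finset.sum_congr rfl fun l' _ => ?_
  rw [Finset.mul_sum]
  refine Finset.sum_congr rfl fun m _ => ?_
  rw [Finset.mul_sum]
  refine Finset.sum_congr rfl fun m' _ => by ring

/-- Linearity of `tcE2c`. [this work] -/
theorem tcE2c_lin (g h : ℕ → ℝ) (a b : ℝ) (F G : Finset ℕ → ℕ → ℕ → Finset ℕ → ℕ → ℕ → ℝ) :
    tcE2c K g h (fun Q l l' Q' m m' => a * F Q l l' Q' m m' + b * G Q l l' Q' m m') = a * tcE2c K g h F + b * tcE2c K g h G := by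
  unfold tcE2c
  simp only [Finset.mul_sum, ← Finset.sum_add_distrib]
  refine Finset.sum_congr rfl fun _ _ => Finset.sum_congr rfl fun _ _ => Finset.sum_congr rfl fun _ _ =>
    Finset.sum_congr rfl fun _ _ => Finset.sum_congr rfl fun _ _ => Finset.sum_congr rfl fun _ _ => by ring

/-- `tcE2c` of a finite sum of functions. [this work] -/
theorem tcE2c_sum (g h : ℕ → ℝ) (s : Finset ℕ) (F : ℕ → Finset ℕ → ℕ → ℕ → Finset ℕ → ℕ → ℕ → ℝ) :
    tcE2c K g h (fun Q l l' Q' m m' => ∑ k ∈ s, F k Q l l' Q' m m') = ∑ k ∈ s, tcE2c K g h (F k) := by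
  induction s using Finset.induction_on with
  | empty =>
    simp only [Finset.sum_empty]
    have := tcE2c_lin (K := K) g h 0 0 (fun _ _ _ _ _ _ => 0) (fun _ _ _ _ _ _ => 0)
    simp only [zero_mul, add_zero] at this
    exact this
  | insert k s hk ih =>
    rw [Finset.sum_insert hk, ← ih]
    have := tcE2c_lin (K := K) g h 1 1 (F k) (fun Q l l' Q' m m' => ∑ k ∈ s, F k Q l l' Q' m m')
    simp only [one_mul] at this
    rw [← this]
    exact congrArg _ (funext fun Q => funext fun l => funext fun l' => funext fun Q' => funext fun m => funext fun m' =>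
      Finset.sum_insert hk)

/-- Exchanging the two copies does not change `tcE2c`. [this work] -/
theorem tcE2c_swap (g h : ℕ → ℝ) (F : Finset ℕ → ℕ → ℕ → Finset ℕ → ℕ → ℕ → ℝ) :
    tcE2c K g h (fun Q l l' Q' m m' => F Q' m m' Q l l') = tcE2c K g h F := by
  unfold tcE2c
  rw [Finset.sum_comm]
  refine Finset.sum_congr rfl fun Q _ => Finset.sum_congr rfl fun Q' _ => ?_
  calc ∑ l ∈ range (K + 2), ∑ l' ∈ range (K + 1), ∑ m ∈ range (K + 2), ∑ m' ∈ range (K + 1),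
        hairW K h Q' * hairW K h Q * (aL K g l * bM K g l' * (aL K g m * bM K g m')) * F Q m m' Q' l l'
      = ∑ l ∈ range (K + 2), ∑ m ∈ range (K + 2), ∑ l' ∈ range (K + 1), ∑ m' ∈ range (K + 1),
        hairW K h Q' * hairW K h Q * (aL K g l * bM K g l' * (aL K g m * bM K g m')) * F Q m m' Q' l l' :=
        Finset.sum_congr rfl fun _ _ => Finset.sum_comm
    _ = ∑ m ∈ range (K + 2), ∑ l ∈ range (K + 2), ∑ l' ∈ range (K + 1), ∑ m' ∈ range (K + 1),
        hairW K h Q' * hairW K h Q * (aL K g l * bM K g l' * (aL K g m * bM K g m')) * F Q m m' Q' l l' :=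
        Finset.sum_comm
    _ = ∑ m ∈ range (K + 2), ∑ l ∈ range (K + 2), ∑ m' ∈ range (K + 1), ∑ l' ∈ range (K + 1),
        hairW K h Q' * hairW K h Q * (aL K g l * bM K g l' * (aL K g m * bM K g m')) * F Q m m' Q' l l' :=
        Finset.sum_congr rfl fun _ _ => Finset.sum_congr rfl fun _ _ => Finset.sum_comm
    _ = ∑ m ∈ range (K + 2), ∑ m' ∈ range (K + 1), ∑ l ∈ range (K + 2), ∑ l' ∈ range (K + 1),
        hairW K h Q' * hairW K h Q * (aL K g l * bM K g l' * (aL K g m * bM K g m')) * F Q m m' Q' l l' :=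
        Finset.sum_congr rfl fun _ _ => Finset.sum_comm
    _ = ∑ m ∈ range (K + 2), ∑ m' ∈ range (K + 1), ∑ l ∈ range (K + 2), ∑ l' ∈ range (K + 1),
        hairW K h Q * hairW K h Q' * (aL K g m * bM K g m' * (aL K g l * bM K g l')) * F Q m m' Q' l l' :=
        Finset.sum_congr rfl fun _ _ => Finset.sum_congr rfl fun _ _ => Finset.sum_congr rfl fun _ _ =>
          Finset.sum_congr rfl fun _ _ => by ring

/-! ## Hair revealing for a configuration-level pair weight -/

section Reveal

variable (Wc : Finset ℕ → ℕ → ℕ → Finset ℕ → ℕ → ℕ → ℤ) (l a m b : ℕ)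

/-- The pair sum of the two pairs `((l,a),(m,b))` and `((l,b),(m,a))` for given open-hair sets of the two copies and split hairs `T`. [this work] -/
def corePSc (HA HB T : Finset ℕ) : ℤ :=
  ∑ J ∈ T.powerset, (Wc (HA ∪ J) l a (HB ∪ (T \ J)) m b + Wc (HA ∪ J) l b (HB ∪ (T \ J)) m a)

/-- The hair-averaged quantity `Ω(S, Z, T)`: hairs in `S` random in both copies, `Z` sure in both, `T` split. [this work] -/
def OmegaGc (h : ℕ → ℝ) (S Z T : Finset ℕ) : ℝ :=
  ∑ Q ∈ S.powerset, ∑ Q' ∈ S.powerset, hw S h Q * hw S h Q' * (corePSc Wc l a m b (Z ∪ Q) (Z ∪ Q') T : ℝ)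

/-- Grouping the two split outcomes of a hair `x ∉ T`. [this work] -/
theorem corePSc_insert {HA HB T : Finset ℕ} {x : ℕ} (hxT : x ∉ T) :
    corePSc Wc l a m b (insert x HA) HB T + corePSc Wc l a m b HA (insert x HB) T = corePSc Wc l a m b HA HB (insert x T) := by
  unfold corePSc
  rw [Finset.sum_powerset_insert hxT, add_comm]
  congr 1
  · refine Finset.sum_congr rfl fun J hJ => ?_
    rw [Finset.mem_powerset] at hJ
    rw [Finset.insert_sdiff_of_notMem _ (fun hx => hxT (hJ hx)), Finset.union_insert, Finset.insert_union]
  · refine Finset.sum_congr rfl fun J hJ => ?_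
    rw [Finset.mem_powerset] at hJ
    rw [Finset.insert_sdiff_insert, Finset.sdiff_insert_of_notMem hxT, Finset.insert_union, Finset.union_insert]

/-- **The revealing identity**: for `x ∉ S ∪ T`,
`Ω(S+x,Z,T) = (1−h x)²·Ω(S,Z,T) + h x (1−h x)·Ω(S,Z,T+x) + (h x)²·Ω(S,Z+x,T)`. [this work] -/
theorem revealc_step (h : ℕ → ℝ) {S Z T : Finset ℕ} {x : ℕ} (hxS : x ∉ S) (hxT : x ∉ T) :
    OmegaGc Wc l a m b h (insert x S) Z T =
      (1 - h x) ^ 2 * OmegaGc Wc l a m b h S Z T + h x * (1 - h x) * OmegaGc Wc l a m b h S Z (insert x T) +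
        h x ^ 2 * OmegaGc Wc l a m b h S (insert x Z) T := by
  classical
  unfold OmegaGc
  rw [Finset.sum_powerset_insert hxS]
  have inner : ∀ Q ∈ S.powerset,
      ∑ Q' ∈ (insert x S).powerset, hw (insert x S) h Q * hw (insert x S) h Q' * (corePSc Wc l a m b (Z ∪ Q) (Z ∪ Q') T : ℝ) +
      ∑ Q' ∈ (insert x S).powerset, hw (insert x S) h (insert x Q) * hw (insert x S) h Q' *
        (corePSc Wc l a m b (Z ∪ insert x Q) (Z ∪ Q') T : ℝ) =
      ∑ Q' ∈ S.powerset, ((1 - h x) ^ 2 * (hw S h Q * hw S h Q' * (corePSc Wc l a m b (Z ∪ Q) (Z ∪ Q') T : ℝ)) +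
        h x * (1 - h x) * (hw S h Q * hw S h Q' * (corePSc Wc l a m b (Z ∪ Q) (Z ∪ Q') (insert x T) : ℝ)) +
        h x ^ 2 * (hw S h Q * hw S h Q' * (corePSc Wc l a m b (insert x Z ∪ Q) (insert x Z ∪ Q') T : ℝ))) := by
    intro Q hQ
    rw [Finset.mem_powerset] at hQ
    rw [Finset.sum_powerset_insert hxS, Finset.sum_powerset_insert hxS, ← Finset.sum_add_distrib, ← Finset.sum_add_distrib,
      ← Finset.sum_add_distrib]
    refine Finset.sum_congr rfl fun Q' hQ' => ?_
    rw [Finset.mem_powerset] at hQ'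
    rw [hw_insert_of_not_mem h hxS hQ, hw_insert_of_not_mem h hxS hQ', hw_insert_insert h hxS, hw_insert_insert h hxS]
    have e1 : Z ∪ insert x Q = insert x (Z ∪ Q) := Finset.union_insert x Z Q
    have e2 : Z ∪ insert x Q' = insert x (Z ∪ Q') := Finset.union_insert x Z Q'
    have e3 : insert x Z ∪ Q = insert x (Z ∪ Q) := Finset.insert_union x Z Q
    have e4 : insert x Z ∪ Q' = insert x (Z ∪ Q') := Finset.insert_union x Z Q'
    rw [e1, e2, e3, e4, ← corePSc_insert Wc l a m b hxT]
    push_cast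
    ring
  rw [← Finset.sum_add_distrib, Finset.sum_congr rfl inner]
  simp only [Finset.sum_add_distrib, ← Finset.mul_sum]

end Reveal

/-- **Hair revealing**: under the core inequality, `Ω(S,Z,T) ≥ 0` for pairwise disjoint `S, Z, T ⊆ range K`, `m ≤ l ≤ K+1`, `a ≤ b ≤ K`,
`h ∈ [0,1]` — induction on `S`. [this work] -/
theorem revealc_nonneg {Wc : Finset ℕ → ℕ → ℕ → Finset ℕ → ℕ → ℕ → ℤ}
    (hW : ∀ l m a b : ℕ, m ≤ l → l ≤ K + 1 → a ≤ b → b ≤ K →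
      ∀ Z T : Finset ℕ, Z ⊆ range K → T ⊆ range K → Disjoint Z T →
        0 ≤ (∑ J ∈ T.powerset, Wc (Z ∪ J) l a (Z ∪ (T \ J)) m b) + ∑ J ∈ T.powerset, Wc (Z ∪ J) l b (Z ∪ (T \ J)) m a)
    {h : ℕ → ℝ} (hh : ∀ k, k < K → 0 ≤ h k ∧ h k ≤ 1) {l m a b : ℕ} (hml : m ≤ l) (hl : l ≤ K + 1) (hab : a ≤ b) (hbK : b ≤ K) :
    ∀ (S Z T : Finset ℕ), S ⊆ range K → Z ⊆ range K → T ⊆ range K → Disjoint S Z → Disjoint S T → Disjoint Z T →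
      0 ≤ OmegaGc Wc l a m b h S Z T := by
  classical
  intro S
  induction S using Finset.induction_on with
  | empty =>
    intro Z T _ hZ hT _ _ hZT
    unfold OmegaGc corePSc
    simp only [Finset.powerset_empty, Finset.sum_singleton, Finset.union_empty]
    have h0 : hw (∅ : Finset ℕ) h ∅ = 1 := by unfold hw; simp
    rw [h0, one_mul, one_mul, Finset.sum_add_distrib]
    exact_mod_cast hW l m a b hml hl hab hbK Z T hZ hT hZT
  | insert x S hxS ih =>
    intro Z T hS hZ hT hSZ hST hZT
    have hxK : x < K := Finset.mem_range.1 (hS (Finset.mem_insert_self x S))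
    have hxZ : x ∉ Z := Finset.disjoint_left.1 hSZ (Finset.mem_insert_self x S)
    have hxT : x ∉ T := Finset.disjoint_left.1 hST (Finset.mem_insert_self x S)
    have hS' : S ⊆ range K := (Finset.subset_insert x S).trans hS
    have hSZ' : Disjoint S Z := hSZ.mono_left (Finset.subset_insert x S)
    have hST' : Disjoint S T := hST.mono_left (Finset.subset_insert x S)
    rw [revealc_step _ _ _ _ _ h hxS hxT]
    have h1 := ih Z T hS' hZ hT hSZ' hST' hZT
    have h2 := ih Z (insert x T) hS' hZ (Finset.insert_subset (Finset.mem_range.2 hxK) hT) hSZ'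
      (Finset.disjoint_insert_right.2 ⟨hxS, hST'⟩) (Finset.disjoint_insert_right.2 ⟨hxZ, hZT⟩)
    have h3 := ih (insert x Z) T hS' (Finset.insert_subset (Finset.mem_range.2 hxK) hZ) hT
      (Finset.disjoint_insert_right.2 ⟨hxS, hSZ'⟩) hST' (Finset.disjoint_insert_left.2 ⟨hxT, hZT⟩)
    have hx0 := (hh x hxK).1
    have hx1 := (hh x hxK).2
    have hx2 : 0 ≤ h x * (1 - h x) := mul_nonneg hx0 (by linarith)
    exact add_nonneg (add_nonneg (mul_nonneg (sq_nonneg _) h1) (mul_nonneg hx2 h2)) (mul_nonneg (sq_nonneg _) h3)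

/-! ## From `Ω` to the two-copy expectation -/

/-- `corePSc` without split hairs. [this work] -/
theorem corePSc_empty (Wc : Finset ℕ → ℕ → ℕ → Finset ℕ → ℕ → ℕ → ℤ) (l a m b : ℕ) (HA HB : Finset ℕ) :
    corePSc Wc l a m b HA HB ∅ = Wc HA l a HB m b + Wc HA l b HB m a := by
  unfold corePSc
  rw [Finset.powerset_empty, Finset.sum_singleton, Finset.sdiff_self, Finset.union_empty, Finset.union_empty]

/-- The hair-averaged double pair sum at `(l, l', m, m')` equals `Ω` with all hairs random. [this work] -/
theorem HHc_eq_OmegaGc (Wc : Finset ℕ → ℕ → ℕ → Finset ℕ → ℕ → ℕ → ℤ) (h : ℕ → ℝ) (l m l' m' : ℕ) :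
    ∑ Q ∈ (range K).powerset, ∑ Q' ∈ (range K).powerset, hairW K h Q * hairW K h Q' *
      ((Wc Q l l' Q' m m' : ℝ) + (Wc Q l m' Q' m l' : ℝ)) =
    OmegaGc Wc l l' m m' h (range K) ∅ ∅ := by
  unfold OmegaGc
  refine Finset.sum_congr rfl fun Q _ => Finset.sum_congr rfl fun Q' _ => ?_
  rw [hw_range_eq, hw_range_eq, Finset.empty_union, Finset.empty_union, corePSc_empty]
  push_cast; ring

/-- `Ω` with the two pairings exchanged (`l' ↔ m'` in the roles of the suffix values). [this work] -/
theorem OmegaGc_pairs_comm (Wc : Finset ℕ → ℕ → ℕ → Finset ℕ → ℕ → ℕ → ℤ) (l a m b : ℕ) (h : ℕ → ℝ) (S Z T : Finset ℕ) :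
    OmegaGc Wc l a m b h S Z T = OmegaGc Wc l b m a h S Z T := by
  unfold OmegaGc corePSc
  refine Finset.sum_congr rfl fun Q _ => Finset.sum_congr rfl fun Q' _ => ?_
  congr 2
  exact Finset.sum_congr rfl fun J _ => add_comm _ _

/-- `Ω` (no split hairs) with the two copies exchanged, `Wc` symmetric. [this work] -/
theorem OmegaGc_copies_comm {Wc : Finset ℕ → ℕ → ℕ → Finset ℕ → ℕ → ℕ → ℤ}
    (hWc : ∀ Q l l' Q' m m', Wc Q l l' Q' m m' = Wc Q' m m' Q l l') (l a m b : ℕ) (h : ℕ → ℝ) (S Z : Finset ℕ) :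
    OmegaGc Wc l a m b h S Z ∅ = OmegaGc Wc m b l a h S Z ∅ := by
  unfold OmegaGc
  rw [Finset.sum_comm]
  refine Finset.sum_congr rfl fun Q _ => Finset.sum_congr rfl fun Q' _ => ?_
  rw [corePSc_empty, corePSc_empty, hWc (Z ∪ Q') l a, hWc (Z ∪ Q') l b]
  ring

/-- **Non-negativity of the hair-averaged double pair sums** for `Wc` symmetric satisfying the core inequality, all `l, m ≤ K+1`,
`l', m' ≤ K`, `h ∈ [0,1]`. [this work] -/
theorem HHc_nonneg {Wc : Finset ℕ → ℕ → ℕ → Finset ℕ → ℕ → ℕ → ℤ}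
    (hW : ∀ l m a b : ℕ, m ≤ l → l ≤ K + 1 → a ≤ b → b ≤ K →
      ∀ Z T : Finset ℕ, Z ⊆ range K → T ⊆ range K → Disjoint Z T →
        0 ≤ (∑ J ∈ T.powerset, Wc (Z ∪ J) l a (Z ∪ (T \ J)) m b) + ∑ J ∈ T.powerset, Wc (Z ∪ J) l b (Z ∪ (T \ J)) m a)
    (hWc : ∀ Q l l' Q' m m', Wc Q l l' Q' m m' = Wc Q' m m' Q l l') {h : ℕ → ℝ} (hh : ∀ k, k < K → 0 ≤ h k ∧ h k ≤ 1)
    {l m l' m' : ℕ} (hl : l ≤ K + 1) (hm : m ≤ K + 1) (hl' : l' ≤ K) (hm' : m' ≤ K) :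
    0 ≤ ∑ Q ∈ (range K).powerset, ∑ Q' ∈ (range K).powerset, hairW K h Q * hairW K h Q' *
      ((Wc Q l l' Q' m m' : ℝ) + (Wc Q l m' Q' m l' : ℝ)) := by
  rw [HHc_eq_OmegaGc]
  have R : ∀ {L M α β : ℕ}, M ≤ L → L ≤ K + 1 → α ≤ β → β ≤ K → 0 ≤ OmegaGc Wc L α M β h (range K) ∅ ∅ :=
    fun hML hL hab hbK => revealc_nonneg hW hh hML hL hab hbK (range K) ∅ ∅ (subset_refl _) (Finset.empty_subset _)
      (Finset.empty_subset _) (Finset.disjoint_empty_right _) (Finset.disjoint_empty_right _) (Finset.disjoint_empty_right _)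
  rcases le_total m l with hml | hlm
  · rcases le_total l' m' with h1 | h1
    · exact R hml hl h1 hm'
    · rw [OmegaGc_pairs_comm]; exact R hml hl h1 hl'
  · rw [OmegaGc_copies_comm hWc]
    rcases le_total m' l' with h1 | h1
    · exact R hlm hm h1 hl'
    · rw [OmegaGc_pairs_comm]; exact R hlm hm h1 hm'

/-- **THE LAW-LEVEL SYMMETRISATION for a general symmetric configuration-level pair weight**: the core inequality and
`g, h ∈ [0,1]` give `0 ≤ tcE2c K g h Wc`. [this work] -/
theorem tcE2c_nonneg_of_core {Wc : Finset ℕ → ℕ → ℕ → Finset ℕ → ℕ → ℕ → ℤ}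
    (hW : ∀ l m a b : ℕ, m ≤ l → l ≤ K + 1 → a ≤ b → b ≤ K →
      ∀ Z T : Finset ℕ, Z ⊆ range K → T ⊆ range K → Disjoint Z T →
        0 ≤ (∑ J ∈ T.powerset, Wc (Z ∪ J) l a (Z ∪ (T \ J)) m b) + ∑ J ∈ T.powerset, Wc (Z ∪ J) l b (Z ∪ (T \ J)) m a)
    (hWc : ∀ Q l l' Q' m m', Wc Q l l' Q' m m' = Wc Q' m m' Q l l')
    {g h : ℕ → ℝ} (hg : ∀ m, m ≤ K → 0 ≤ g m ∧ g m ≤ 1) (hh : ∀ k, k < K → 0 ≤ h k ∧ h k ≤ 1) :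
    0 ≤ tcE2c K g h (fun Q l l' Q' m m' => (Wc Q l l' Q' m m' : ℝ)) := by
  have e1 : tcE2c K g h (fun Q l l' Q' m m' => (Wc Q l l' Q' m m' : ℝ)) =
      ∑ l ∈ range (K + 2), ∑ l' ∈ range (K + 1), ∑ m ∈ range (K + 2), ∑ m' ∈ range (K + 1),
        ∑ Q ∈ (range K).powerset, ∑ Q' ∈ (range K).powerset,
          hairW K h Q * hairW K h Q' * (aL K g l * bM K g l' * (aL K g m * bM K g m')) * (Wc Q l l' Q' m m' : ℝ) := by
    unfold tcE2c; exact sum_reorder6 _ _ _ _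
  have e2 : tcE2c K g h (fun Q l l' Q' m m' => (Wc Q l l' Q' m m' : ℝ)) =
      ∑ l ∈ range (K + 2), ∑ l' ∈ range (K + 1), ∑ m ∈ range (K + 2), ∑ m' ∈ range (K + 1),
        ∑ Q ∈ (range K).powerset, ∑ Q' ∈ (range K).powerset,
          hairW K h Q * hairW K h Q' * (aL K g l * bM K g l' * (aL K g m * bM K g m')) * (Wc Q l m' Q' m l' : ℝ) := by
    unfold tcE2c
    rw [sum_relabel6]
    rw [sum_reorder6]
    refine Finset.sum_congr rfl fun l _ => Finset.sum_congr rfl fun l' _ => Finset.sum_congr rfl fun m _ =>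
      Finset.sum_congr rfl fun m' _ => Finset.sum_congr rfl fun Q _ => Finset.sum_congr rfl fun Q' _ => by ring
  have e3 : 2 * tcE2c K g h (fun Q l l' Q' m m' => (Wc Q l l' Q' m m' : ℝ)) =
      ∑ l ∈ range (K + 2), ∑ l' ∈ range (K + 1), ∑ m ∈ range (K + 2), ∑ m' ∈ range (K + 1),
        (aL K g l * bM K g l' * (aL K g m * bM K g m')) *
        ∑ Q ∈ (range K).powerset, ∑ Q' ∈ (range K).powerset, hairW K h Q * hairW K h Q' *
          ((Wc Q l l' Q' m m' : ℝ) + (Wc Q l m' Q' m l' : ℝ)) := by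
    rw [two_mul]
    nth_rewrite 1 [e1]
    rw [e2]
    simp only [← Finset.sum_add_distrib, Finset.mul_sum]
    refine Finset.sum_congr rfl fun l _ => Finset.sum_congr rfl fun l' _ => Finset.sum_congr rfl fun m _ =>
      Finset.sum_congr rfl fun m' _ => Finset.sum_congr rfl fun Q _ => Finset.sum_congr rfl fun Q' _ => by ring
  have h2 : 0 ≤ 2 * tcE2c K g h (fun Q l l' Q' m m' => (Wc Q l l' Q' m m' : ℝ)) := by
    rw [e3]
    refine Finset.sum_nonneg fun l hl => Finset.sum_nonneg fun l' hl' => Finset.sum_nonneg fun m hm => Finset.sum_nonneg fun m' hm' => ?_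
    rw [Finset.mem_range] at hl hl' hm hm'
    exact mul_nonneg (mul_nonneg (mul_nonneg (aL_nonneg hg l) (bM_nonneg hg (by omega)))
      (mul_nonneg (aL_nonneg hg m) (bM_nonneg hg (by omega)))) (HHc_nonneg hW hWc hh (by omega) (by omega) (by omega) (by omega))
  linarith

end TK

end Summit.CriticalPhenomena.PercolationContinuityZ3.Theorems.HairyCycle

end
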